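import Mathlib.Analysis.SpecialFunctions.Gamma.Basic
import Mathlib.Analysis.SpecialFunctions.Gaussian.GaussianIntegral
import Mathlib.Analysis.SpecialFunctions.Pow.Real
import Mathlib.Analysis.Calculus.Deriv.MeanValue
import Mathlib.Analysis.Complex.ExponentialBounds
import Mathlib.Analysis.Real.Pi.Bounds
import Mathlib.MeasureTheory.Group.Integral
import Mathlib.MeasureTheory.Measure.Lebesgue.Integral
import Mathlib.MeasureTheory.Integral.ExpDecay
import HarnessLib

/-!
# Laplace-method concentration for the weight `u^s e^{9u - π e^{4u}}` — proved

Trunk T-ANT (`Literature/NumberTheory/LFunctions`). Mathlib-only analytic input for the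
asymptotics of the Taylor coefficients `γ(n)` of `ξ` at `s = 1/2` (Griffin–Ono–Rolen–Zagier,
PNAS 116 (2019), Thm. 7 and §5.1), consumed by `XiMomentConcentration.lean` and
`JensenAsymptotics.lean` on the way to GORZ Thm. 1 (`Literature.NumberTheory.LFunctions.gorz_eventually`).

By `XiMoments.lean`, `γ(n)` is a positive multiple of the moment `M_{2n} = ∫₀^∞ Φ(u) u^{2n} du`
of the Pólya–de Bruijn kernel `Φ` (Rodgers–Tao normalisation), whose leading term is
`2π² e^{ψ(u)}` with `ψ(u) = 9u - π e^{4u}`; in fact `c₀ e^{ψ} ≤ Φ ≤ C₀ e^{ψ}` on `[0, ∞)`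
(`XiMomentConcentration.lean`). The moments are therefore governed by the weight
`e^{H_s(u)} = u^s e^{ψ(u)}`, `H_s(u) = s log u + ψ(u)`, which is concave in `u` with its maximum
at the saddle point `a_s > 0`, `4π e^{4a_s} = s/a_s + 9` (GORZ's `a = e^{L}`, `n = L(πe^L + 3/4)`,
in the variable `t = e^{4u}` up to normalisation; §4, proof of Thm. 7: "we can then apply the
usual saddle point method"). GORZ need the expansion of Thm. 7 to all orders only to identify
the shape (15) of `log(γ(n+j)/γ(n))`; for Thm. 1 the following crude two-sided Laplace estimate
suffices, and this file proves it from scratch. Put `λ_s = s/a_s + 9 = 4π e^{4a_s}` (so that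
`4λ_s ≤ -H_s''(a_s) = s/a_s² + 4λ_s ≤ 5λ_s` once `a_s ≥ 1`).

## Contents (all proved, Mathlib only)

* `Literature.NumberTheory.LFunctions.XiKernel.psi`, `Literature.NumberTheory.LFunctions.XiKernel.H`, `Literature.NumberTheory.LFunctions.XiKernel.saddle` (`a_s`, with `saddle_eq`),
  `Literature.NumberTheory.LFunctions.XiKernel.lam` (`λ_s`); `tendsto_saddle_atTop`, `tendsto_lam_atTop` (`a_s, λ_s → ∞`).
* `H_sub_le` (global): `H_s(u) - H_s(a_s) ≤ -(2/5) λ_s min((u - a_s)², |u - a_s|)` for `u > 0`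
  (concavity of `s log u`, and `e^{x} ≥ 1 + x + x²/2`, `1 - e^{-4t} ≥ 4t/5` on `[0,1]`).
* `H_sub_ge` (local): `H_s(a_s + t) - H_s(a_s) ≥ -5 λ_s t²` for `0 ≤ t ≤ 1/4`, `a_s ≥ 1`.
* `integral_abs_pow_mul_expH_le`: `∫₀^∞ |u - a_s|^l e^{H_s(u) - H_s(a_s)} du ≤ 2e·l!/κ^{l+1}`,
  `κ = √((2/5)λ_s)`; `integral_expH_ge`: `∫₀^∞ e^{H_s(u) - H_s(a_s)} du ≥ e^{-5/16}/(4√λ_s)`.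
* `exists_moment_bound` (**the export**): for each `l` a constant `C_l` with
  `∫₀^∞ |u - a_s|^l e^{H_s(u)} du ≤ C_l λ_s^{-l/2} ∫₀^∞ e^{H_s(u)} du` (`a_s ≥ 1`, `λ_s ≥ 5/2`).

## References

* M. Griffin, K. Ono, L. Rolen, D. Zagier, *Jensen polynomials for the Riemann zeta function and
  other sequences*, PNAS 116 (2019) 11103–11110, §4 (proof of Thm. 7, saddle point at `a = e^L`)
  and §5.1. [GORZPNAS2019]
* B. Rodgers, T. Tao, *The de Bruijn–Newman constant is non-negative*, Forum Math. Pi 8 (2020),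
  eqs. (1)–(3) (the normalisation `Φ(u) = ∑ (2π²n⁴e^{9u} - 3πn²e^{5u}) e^{-πn²e^{4u}}`).
-/

noncomputable section

open Real MeasureTheory Set Filter Topology
open scoped Nat

namespace Literature.NumberTheory.LFunctions

namespace XiKernel

/-- `ψ(u) = 9u - π e^{4u}`, the exponent of the leading term `2π² e^{9u - π e^{4u}}` of the
Pólya–de Bruijn kernel `Φ(u)`. [folklore] -/
def psi (u : ℝ) : ℝ := 9 * u - π * exp (4 * u)

/-- `H_s(u) = s log u + ψ(u)`, so that `e^{H_s(u)} = u^s e^{ψ(u)}` for `u > 0`. [folklore] -/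
def H (s u : ℝ) : ℝ := s * log u + psi u

/-! ### Elementary exponential inequalities -/

/-- For `t ≥ 0`: `t - (e^{4t} - 1)/4 ≤ -2t²` (from `e^x ≥ 1 + x + x²/2`). [folklore] -/
theorem sub_exp_sub_one_div_le {t : ℝ} (ht : 0 ≤ t) : t - (exp (4 * t) - 1) / 4 ≤ -2 * t ^ 2 := by
  have := quadratic_le_exp_of_nonneg (by linarith : (0 : ℝ) ≤ 4 * t)
  nlinarith

/-- For `0 ≤ t ≤ 1`: `4t/5 ≤ 1 - e^{-4t}` (from `e^x ≥ 1 + x`). [folklore] -/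
theorem lin_le_one_sub_exp_neg {t : ℝ} (ht0 : 0 ≤ t) (ht1 : t ≤ 1) :
    4 * t / 5 ≤ 1 - exp (-(4 * t)) := by
  have h1 : 4 * t + 1 ≤ exp (4 * t) := add_one_le_exp _
  have hpos : 0 < 4 * t + 1 := by linarith
  have h2 : exp (-(4 * t)) ≤ (4 * t + 1)⁻¹ := by
    rw [exp_neg]; exact inv_anti₀ hpos h1
  have h3 : 4 * t / 5 ≤ 4 * t / (4 * t + 1) :=
    div_le_div_of_nonneg_left (by linarith) hpos (by linarith)
  have h4 : 4 * t / (4 * t + 1) = 1 - (4 * t + 1)⁻¹ := by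
    field_simp; ring
  linarith

/-- The left-tail rate function `g(t) = t - (1 - e^{-4t})/4`. [folklore] -/
def gfun (t : ℝ) : ℝ := t - (1 - exp (-(4 * t))) / 4

/-- `g(t) - 2t²/5` is nondecreasing on `[0, 1]` (its derivative is `1 - e^{-4t} - 4t/5 ≥ 0`).
[folklore] -/
theorem monotoneOn_gfun_sub : MonotoneOn (fun t ↦ gfun t - 2 / 5 * t ^ 2) (Icc 0 1) := by
  have hderiv : ∀ t, HasDerivAt (fun t ↦ gfun t - 2 / 5 * t ^ 2)
      (1 - exp (-(4 * t)) - 4 * t / 5) t := by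
    intro t
    have h1 : HasDerivAt (fun t : ℝ ↦ exp (-(4 * t))) (exp (-(4 * t)) * (-4)) t := by
      have := ((hasDerivAt_id t).const_mul 4).neg.exp
      simpa using this
    have h2 : HasDerivAt (fun t ↦ gfun t - 2 / 5 * t ^ 2)
        ((1 : ℝ) - -(exp (-(4 * t)) * -4) / 4 - 2 / 5 * (↑(2 : ℕ) * t ^ (2 - 1))) t :=
      ((hasDerivAt_id t).sub ((h1.const_sub 1).div_const 4)).sub
        ((hasDerivAt_pow 2 t).const_mul (2 / 5))
    refine h2.congr_deriv ?_
    norm_num; ring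
  refine monotoneOn_of_deriv_nonneg (convex_Icc 0 1)
    (fun t _ ↦ (hderiv t).continuousAt.continuousWithinAt)
    (fun t _ ↦ (hderiv t).differentiableAt.differentiableWithinAt) ?_
  intro t ht
  rw [interior_Icc] at ht
  rw [(hderiv t).deriv]
  have := lin_le_one_sub_exp_neg ht.1.le ht.2.le
  linarith

/-- `g(t) ≥ (2/5) min(t², t)` for `t ≥ 0`. [folklore] -/
theorem gfun_ge {t : ℝ} (ht : 0 ≤ t) : 2 / 5 * min (t ^ 2) t ≤ gfun t := by
  rcases le_or_gt t 1 with h1 | h1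
  · have hmono := monotoneOn_gfun_sub ⟨le_rfl, zero_le_one⟩ ⟨ht, h1⟩ ht
    simp only [gfun] at hmono ⊢
    have : min (t ^ 2) t ≤ t ^ 2 := min_le_left _ _
    have h0 : Real.exp (-(4 * (0 : ℝ))) = 1 := by simp
    rw [h0] at hmono
    nlinarith
  · have hmin : min (t ^ 2) t ≤ t := min_le_right _ _
    have hexp : 0 < exp (-(4 * t)) := exp_pos _
    simp only [gfun]
    nlinarith

/-! ### The saddle point -/

/-- For `s > 0` there is `a > 0` with `4π e^{4a} = s/a + 9` (intermediate value theorem).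
[folklore] -/
theorem exists_saddle {s : ℝ} (hs : 0 < s) :
    ∃ a : ℝ, 0 < a ∧ 4 * π * exp (4 * a) = s / a + 9 := by
  set f : ℝ → ℝ := fun a ↦ 4 * π * exp (4 * a) - s / a - 9 with hf
  set a₁ : ℝ := min 1 (s / 1000) with ha₁
  set a₂ : ℝ := max 1 s with ha₂
  have ha₁pos : 0 < a₁ := lt_min one_pos (by positivity)
  have ha₁le : a₁ ≤ 1 := min_le_left _ _
  have ha₂ge : 1 ≤ a₂ := le_max_left _ _
  have h12 : a₁ ≤ a₂ := ha₁le.trans ha₂ge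
  have hcont : ContinuousOn f (Icc a₁ a₂) := by
    have : ∀ a ∈ Icc a₁ a₂, a ≠ 0 := fun a ha ↦ (ha₁pos.trans_le ha.1).ne'
    apply ContinuousOn.sub
    · apply ContinuousOn.sub
      · exact (continuous_const.mul (continuous_exp.comp (continuous_const.mul
          continuous_id))).continuousOn
      · exact continuousOn_const.div continuousOn_id this
    · exact continuousOn_const
  -- f a₁ ≤ 0
  have hpi : π < 3.15 := pi_lt_d2
  have he : exp 1 < 2.7182818286 := exp_one_lt_d9
  have he4 : exp (4 * a₁) ≤ 55 := by
    have : exp (4 * a₁) ≤ exp (4 * 1) := exp_le_exp.2 (by linarith)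
    have h4 : exp (4 * 1) = (exp 1) ^ 4 := by rw [← exp_nat_mul]; norm_num
    have hpos : 0 < exp 1 := exp_pos 1
    nlinarith [pow_le_pow_left₀ hpos.le he.le 4]
  have hsa₁ : 1000 ≤ s / a₁ := by
    rw [le_div_iff₀ ha₁pos]
    have : a₁ ≤ s / 1000 := min_le_right _ _
    linarith [this]
  have hf₁ : f a₁ ≤ 0 := by
    simp only [hf]
    nlinarith [pi_pos]
  -- 0 ≤ f a₂
  have hsa₂ : s / a₂ ≤ 1 := by
    rw [div_le_one (by positivity)]
    exact le_max_right _ _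
  have he4' : 5 ≤ exp (4 * a₂) := by
    have := add_one_le_exp (4 * a₂)
    linarith
  have hf₂ : 0 ≤ f a₂ := by
    simp only [hf]
    nlinarith [pi_gt_three]
  obtain ⟨a, ha, hfa⟩ := intermediate_value_Icc h12 hcont ⟨hf₁, hf₂⟩
  exact ⟨a, ha₁pos.trans_le ha.1, by simp only [hf] at hfa; linarith⟩

/-- The saddle point `a_s > 0` of `H_s`, `4π e^{4a_s} = s/a_s + 9` (for `s > 0`; junk value `1`
otherwise). [folklore] -/
def saddle (s : ℝ) : ℝ := if hs : 0 < s then (exists_saddle hs).choose else 1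

/-- `a_s > 0`. [folklore] -/
theorem saddle_pos (s : ℝ) : 0 < saddle s := by
  unfold saddle; split_ifs with hs
  · exact (exists_saddle hs).choose_spec.1
  · exact one_pos

/-- The defining equation `4π e^{4 a_s} = s/a_s + 9` of the saddle point (`s > 0`). [folklore] -/
theorem saddle_eq {s : ℝ} (hs : 0 < s) : 4 * π * exp (4 * saddle s) = s / saddle s + 9 := by
  unfold saddle; rw [dif_pos hs]; exact (exists_saddle hs).choose_spec.2

/-- `λ_s = s/a_s + 9 (= 4π e^{4a_s})`, the curvature scale of `H_s` at the saddle. [folklore] -/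
def lam (s : ℝ) : ℝ := s / saddle s + 9

/-- `λ_s = 4π e^{4 a_s}` (`s > 0`). [folklore] -/
theorem lam_eq {s : ℝ} (hs : 0 < s) : lam s = 4 * π * exp (4 * saddle s) := by
  rw [lam, saddle_eq hs]

/-- `λ_s > 0` (`s > 0`). [folklore] -/
theorem lam_pos {s : ℝ} (hs : 0 < s) : 0 < lam s := by
  rw [lam_eq hs]; positivity

/-- `s/a_s ≤ λ_s`. [folklore] -/
theorem div_saddle_le_lam (s : ℝ) : s / saddle s ≤ lam s := by
  rw [lam]; linarith

/-- `a_s → ∞` as `s → ∞`. [folklore] -/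
theorem tendsto_saddle_atTop : Tendsto saddle atTop atTop := by
  refine tendsto_atTop_atTop.2 fun A ↦ ?_
  set A' : ℝ := max A 1 with hA'
  have hA'pos : 0 < A' := lt_of_lt_of_le one_pos (le_max_right _ _)
  refine ⟨A' * (4 * π * exp (4 * A')) + 1, fun s hs ↦ ?_⟩
  have hspos : 0 < s := by
    have : 0 < A' * (4 * π * exp (4 * A')) := by positivity
    linarith
  by_contra hlt
  push Not at hlt
  have hlt' : saddle s < A' := lt_of_lt_of_le hlt (le_max_left _ _)
  have hsad := saddle_pos s
  have h1 : s / A' < s / saddle s := div_lt_div_of_pos_left hspos hsad hlt'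
  have h2 : 4 * π * exp (4 * A') ≤ s / A' := by
    rw [le_div_iff₀ hA'pos]; linarith
  have h3 : 4 * π * exp (4 * saddle s) < 4 * π * exp (4 * A') := by
    gcongr
  have h4 := saddle_eq hspos
  linarith

/-- `λ_s → ∞` as `s → ∞`. [folklore] -/
theorem tendsto_lam_atTop : Tendsto lam atTop atTop := by
  have h : ∀ᶠ s in atTop, 4 * π * exp (4 * saddle s) = lam s :=
    (eventually_gt_atTop 0).mono fun s hs ↦ (lam_eq hs).symm
  refine Tendsto.congr' h ?_
  refine Tendsto.const_mul_atTop (by positivity) ?_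
  exact tendsto_exp_atTop.comp (tendsto_saddle_atTop.const_mul_atTop (by norm_num))

/-! ### Pointwise bounds for `H_s(u) - H_s(a_s)` -/

/-- **Global upper bound**: `H_s(u) - H_s(a_s) ≤ -(2/5) λ_s min((u - a_s)², |u - a_s|)` for all
`u > 0`. [folklore] -/
theorem H_sub_le {s u : ℝ} (hs : 0 < s) (hu : 0 < u) :
    H s u - H s (saddle s) ≤ -(2 / 5 * lam s * min ((u - saddle s) ^ 2) |u - saddle s|) := by
  set a := saddle s with ha
  have hapos : 0 < a := saddle_pos s
  have hlam : lam s = 4 * π * exp (4 * a) := lam_eq hs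
  have hlampos : 0 < lam s := lam_pos hs
  have hlog : s * log u - s * log a ≤ s / a * (u - a) := by
    have h1 : log (u / a) ≤ u / a - 1 := log_le_sub_one_of_pos (div_pos hu hapos)
    rw [log_div hu.ne' hapos.ne'] at h1
    have h2 : u / a - 1 = (u - a) / a := by field_simp
    rw [h2] at h1
    have := mul_le_mul_of_nonneg_left h1 hs.le
    calc s * log u - s * log a = s * (log u - log a) := by ring
      _ ≤ s * ((u - a) / a) := this
      _ = s / a * (u - a) := by ring
  simp only [H, psi]
  have hlamdef : lam s = s / a + 9 := rfl
  have hlam4 : π * exp (4 * a) = lam s / 4 := by rw [hlam]; ring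
  rcases le_or_gt a u with hau | hau
  · -- right of the saddle: t = u - a ≥ 0
    set t := u - a with ht
    have ht0 : 0 ≤ t := by linarith
    have hexp : exp (4 * u) = exp (4 * a) * exp (4 * t) := by
      rw [← exp_add]; congr 1; rw [ht]; ring
    have hmin : min (t ^ 2) |t| ≤ t ^ 2 := min_le_left _ _
    have key := sub_exp_sub_one_div_le ht0
    calc s * log u + (9 * u - π * exp (4 * u)) - (s * log a + (9 * a - π * exp (4 * a)))
        = (s * log u - s * log a) + 9 * (u - a) - π * (exp (4 * u) - exp (4 * a)) := by ring
      _ = (s * log u - s * log a) + 9 * t - π * exp (4 * a) * (exp (4 * t) - 1) := by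
          rw [hexp]; ring
      _ ≤ s / a * t + 9 * t - lam s / 4 * (exp (4 * t) - 1) := by rw [← hlam4]; linarith [hlog]
      _ = lam s * (t - (exp (4 * t) - 1) / 4) := by rw [hlamdef]; ring
      _ ≤ lam s * (-2 * t ^ 2) := mul_le_mul_of_nonneg_left key hlampos.le
      _ ≤ -(2 / 5 * lam s * min (t ^ 2) |t|) := by
          nlinarith [mul_le_mul_of_nonneg_left hmin hlampos.le]
  · -- left of the saddle: t = a - u > 0
    set t := a - u with ht
    have ht0 : 0 ≤ t := by linarith
    have hexp : exp (4 * u) = exp (4 * a) * exp (-(4 * t)) := by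
      rw [← exp_add]; congr 1; rw [ht]; ring
    have habs : |u - a| = t := by rw [abs_sub_comm]; exact abs_of_nonneg ht0
    have hsq : (u - a) ^ 2 = t ^ 2 := by rw [ht]; ring
    rw [habs, hsq]
    have key := gfun_ge ht0
    simp only [gfun] at key
    calc s * log u + (9 * u - π * exp (4 * u)) - (s * log a + (9 * a - π * exp (4 * a)))
        = (s * log u - s * log a) + 9 * (u - a) - π * (exp (4 * u) - exp (4 * a)) := by ring
      _ = (s * log u - s * log a) - 9 * t + π * exp (4 * a) * (1 - exp (-(4 * t))) := by
          rw [hexp]; ring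
      _ ≤ -(s / a * t) - 9 * t + lam s / 4 * (1 - exp (-(4 * t))) := by
          rw [← hlam4]
          have : s / a * (u - a) = -(s / a * t) := by rw [ht]; ring
          linarith [hlog]
      _ = -(lam s * (t - (1 - exp (-(4 * t))) / 4)) := by rw [hlamdef]; ring
      _ ≤ -(lam s * (2 / 5 * min (t ^ 2) t)) := by
          have := mul_le_mul_of_nonneg_left key hlampos.le
          linarith
      _ = -(2 / 5 * lam s * min (t ^ 2) t) := by ring

/-- **Local lower bound**: for `a_s ≥ 1` and `0 ≤ t ≤ 1/4`,
`H_s(a_s + t) - H_s(a_s) ≥ -5 λ_s t²`. [folklore] -/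
theorem H_sub_ge {s t : ℝ} (hs : 0 < s) (ha : 1 ≤ saddle s) (ht0 : 0 ≤ t) (ht1 : t ≤ 1 / 4) :
    -(5 * lam s * t ^ 2) ≤ H s (saddle s + t) - H s (saddle s) := by
  set a := saddle s with ha'
  have hapos : 0 < a := saddle_pos s
  have hlam : lam s = 4 * π * exp (4 * a) := lam_eq hs
  have hlampos : 0 < lam s := lam_pos hs
  -- log (a + t) - log a ≥ t/a - t²/a²
  have hlog : s * (t / a) - s * (t ^ 2 / a ^ 2) ≤ s * log (a + t) - s * log a := by
    have hx : 0 ≤ t / a := div_nonneg ht0 hapos.le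
    have h1 : 1 - (1 + t / a)⁻¹ ≤ log (1 + t / a) := one_sub_inv_le_log_of_pos (by linarith)
    have h2 : t / a - (t / a) ^ 2 ≤ 1 - (1 + t / a)⁻¹ := by
      rw [show 1 - (1 + t / a)⁻¹ = (t / a) / (1 + t / a) by field_simp; ring]
      rw [le_div_iff₀ (by linarith)]
      nlinarith [sq_nonneg (t / a), mul_nonneg hx (sq_nonneg (t / a))]
    have h3 : log (1 + t / a) = log (a + t) - log a := by
      rw [← log_div (by linarith) hapos.ne']; congr 1; field_simp
    have h4 : (t / a) ^ 2 = t ^ 2 / a ^ 2 := by ring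
    nlinarith [mul_le_mul_of_nonneg_left (h2.trans h1) hs.le]
  -- e^{4t} - 1 - 4t ≤ 16 t²
  have hexp4 : exp (4 * t) - 1 - 4 * t ≤ 16 * t ^ 2 := by
    have := abs_exp_sub_one_sub_id_le (x := 4 * t) (by rw [abs_of_nonneg (by linarith)]; linarith)
    have := (le_abs_self _).trans this
    nlinarith
  have hexp : exp (4 * (a + t)) = exp (4 * a) * exp (4 * t) := by
    rw [← exp_add]; congr 1; ring
  have hsa : s / a ^ 2 ≤ lam s := by
    calc s / a ^ 2 ≤ s / a := by
          rw [div_le_div_iff_of_pos_left hs (by positivity) hapos]; nlinarith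
      _ ≤ lam s := div_saddle_le_lam s
  have hlam4 : π * exp (4 * a) = lam s / 4 := by rw [hlam]; ring
  simp only [H, psi]
  rw [hexp, hlam4]
  have e1 : s * (t / a) = s / a * t := by ring
  have e2 : s * (t ^ 2 / a ^ 2) = s / a ^ 2 * t ^ 2 := by ring
  rw [e1, e2] at hlog
  have hlamdef : lam s = s / a + 9 := rfl
  nlinarith [mul_le_mul_of_nonneg_left hexp4 hlampos.le,
    mul_le_mul_of_nonneg_right hsa (sq_nonneg t), exp_pos (4 * a)]

/-! ### `e^{H_s}` as a weight: measurability, domination, integrability -/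

/-- `e^{H_s(u)} = u^s e^{ψ(u)}` for `u > 0`. [folklore] -/
theorem exp_H {s u : ℝ} (hu : 0 < u) : exp (H s u) = u ^ s * exp (psi u) := by
  rw [H, exp_add, rpow_def_of_pos hu, mul_comm (log u)]

/-- `u ↦ e^{H_s(u) - H_s(a_s)}` is continuous on `(0, ∞)`. [folklore] -/
theorem continuousOn_expH (s : ℝ) :
    ContinuousOn (fun u ↦ exp (H s u - H s (saddle s))) (Ioi 0) := by
  have hlog : ContinuousOn log (Ioi (0 : ℝ)) :=
    continuousOn_log.mono fun u hu ↦ ne_of_gt hu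
  have hH : ContinuousOn (fun u ↦ H s u) (Ioi 0) := by
    unfold H psi
    exact ((continuousOn_const.mul hlog).add (by fun_prop))
  exact continuous_exp.comp_continuousOn (hH.sub continuousOn_const)

/-- The comparison kernel `k_{κ,l}(x) = x^l e^{-κx}`. [folklore] -/
def kfun (κ : ℝ) (l : ℕ) (x : ℝ) : ℝ := x ^ l * exp (-(κ * x))

/-- `k_{κ,l}(x) ≥ 0` for `x ≥ 0`. [folklore] -/
theorem kfun_nonneg {κ x : ℝ} (hx : 0 ≤ x) (l : ℕ) : 0 ≤ kfun κ l x := by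
  unfold kfun; positivity

/-- `k_{κ,l}` is continuous. [folklore] -/
theorem continuous_kfun (κ : ℝ) (l : ℕ) : Continuous (kfun κ l) := by
  unfold kfun; fun_prop

/-- `∫₀^∞ x^l e^{-κx} dx = l!/κ^{l+1}`. [folklore] -/
theorem integral_kfun {κ : ℝ} (hκ : 0 < κ) (l : ℕ) :
    ∫ x in Ioi 0, kfun κ l x = (l ! : ℝ) / κ ^ (l + 1) := by
  have h := Real.integral_rpow_mul_exp_neg_mul_Ioi (a := (l : ℝ) + 1) (r := κ) (by positivity) hκ
  rw [add_sub_cancel_right, show (l : ℝ) + 1 = ((l + 1 : ℕ) : ℝ) by push_cast; ring,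
    rpow_natCast, Nat.cast_succ, Gamma_nat_eq_factorial] at h
  have h' : ∫ x in Ioi 0, kfun κ l x = ∫ t in Ioi (0 : ℝ), t ^ (l : ℝ) * exp (-(κ * t)) :=
    setIntegral_congr_fun measurableSet_Ioi fun t _ ↦ by rw [kfun, rpow_natCast]
  rw [h', h, one_div, inv_pow, ← div_eq_inv_mul]

/-- `x^l e^{-κx}` is integrable on `(0, ∞)` for `κ > 0`. [folklore] -/
theorem integrableOn_kfun {κ : ℝ} (hκ : 0 < κ) (l : ℕ) : IntegrableOn (kfun κ l) (Ioi 0) := by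
  have h := integrableOn_rpow_mul_exp_neg_mul_rpow (s := (l : ℝ)) (p := 1) (b := κ)
    (by have := Nat.cast_nonneg (α := ℝ) l; linarith) le_rfl hκ
  refine h.congr_fun (fun x _ ↦ ?_) measurableSet_Ioi
  show x ^ (l : ℝ) * rexp (-κ * x ^ (1 : ℝ)) = kfun κ l x
  rw [kfun, rpow_natCast, rpow_one, neg_mul]

/-- If `f` is integrable on `(0, ∞)` then `x ↦ f |x|` is integrable on `ℝ`. [folklore] -/
theorem integrable_comp_abs_of_integrableOn {f : ℝ → ℝ} (hf : IntegrableOn f (Ioi 0)) :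
    Integrable fun x ↦ f |x| := by
  have hIoi : IntegrableOn (fun x ↦ f |x|) (Ioi 0) :=
    hf.congr_fun (fun x hx ↦ by rw [abs_of_pos (mem_Ioi.1 hx)]) measurableSet_Ioi
  have hIic : IntegrableOn (fun x ↦ f |x|) (Iic 0) := by
    rw [← Measure.map_neg_eq_self (volume : Measure ℝ)]
    let m : MeasurableEmbedding fun x : ℝ ↦ -x := (Homeomorph.neg ℝ).measurableEmbedding
    rw [m.integrableOn_map_iff]
    simp_rw [Function.comp_def, abs_neg, neg_preimage, neg_Iic, neg_zero]
    exact Iff.mpr integrableOn_Ici_iff_integrableOn_Ioi hIoi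
  have := hIic.union hIoi
  rwa [Iic_union_Ioi, integrableOn_univ] at this

/-- `c · min(t², |t|) ≥ √c |t| - 1` for `c ≥ 1`. [folklore] -/
theorem sqrt_mul_abs_sub_one_le {c t : ℝ} (hc : 1 ≤ c) :
    sqrt c * |t| - 1 ≤ c * min (t ^ 2) |t| := by
  have hsq : sqrt c ^ 2 = c := sq_sqrt (by linarith)
  have hsc : 1 ≤ sqrt c := by rwa [le_sqrt (by norm_num) (by linarith), one_pow]
  rcases le_total (t ^ 2) |t| with h | h
  · rw [min_eq_left h]
    nlinarith [sq_nonneg (sqrt c * |t| - 1), sq_abs t]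
  · rw [min_eq_right h]
    have h1 : sqrt c ≤ c := by nlinarith
    nlinarith [mul_le_mul_of_nonneg_right h1 (abs_nonneg t), abs_nonneg t]

/-- **Domination**: for `(2/5) λ_s ≥ 1`, `κ = √((2/5) λ_s)`, all `u > 0` and `l`:
`|u - a_s|^l e^{H_s(u) - H_s(a_s)} ≤ e · k_{κ,l}(|u - a_s|)`. [folklore] -/
theorem abs_pow_mul_expH_le {s u : ℝ} (hs : 0 < s) (hc : 1 ≤ 2 / 5 * lam s) (hu : 0 < u) (l : ℕ) :
    |u - saddle s| ^ l * exp (H s u - H s (saddle s)) ≤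
      exp 1 * kfun (sqrt (2 / 5 * lam s)) l |u - saddle s| := by
  have h1 := H_sub_le hs hu (s := s)
  have h2 := sqrt_mul_abs_sub_one_le (t := u - saddle s) hc
  rw [kfun, mul_left_comm, ← exp_add]
  gcongr
  linarith

/-- `u ↦ |u - a_s|^l e^{H_s(u) - H_s(a_s)}` is integrable on `(0, ∞)` (for `(2/5) λ_s ≥ 1`).
[folklore] -/
theorem integrableOn_abs_pow_mul_expH {s : ℝ} (hs : 0 < s) (hc : 1 ≤ 2 / 5 * lam s) (l : ℕ) :
    IntegrableOn (fun u ↦ |u - saddle s| ^ l * exp (H s u - H s (saddle s))) (Ioi 0) := by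
  have hκ : 0 < sqrt (2 / 5 * lam s) := sqrt_pos.2 (by linarith)
  have hG : Integrable fun u ↦ exp 1 * kfun (sqrt (2 / 5 * lam s)) l |u - saddle s| :=
    (((integrable_comp_abs_of_integrableOn (integrableOn_kfun hκ l)).comp_sub_right
      (saddle s)).const_mul (exp 1))
  refine hG.integrableOn.mono' ?_ (ae_restrict_of_forall_mem measurableSet_Ioi fun u hu ↦ ?_)
  · exact ((continuous_abs.comp (continuous_id.sub continuous_const)).pow l
      |>.continuousOn.mul (continuousOn_expH s)).aestronglyMeasurable measurableSet_Ioi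
  · rw [Real.norm_eq_abs, abs_of_nonneg (by positivity)]
    exact abs_pow_mul_expH_le hs hc hu l

/-- Case `l = 0`: `e^{H_s - H_s(a_s)}` is integrable on `(0, ∞)`. [folklore] -/
theorem integrableOn_expH {s : ℝ} (hs : 0 < s) (hc : 1 ≤ 2 / 5 * lam s) :
    IntegrableOn (fun u ↦ exp (H s u - H s (saddle s))) (Ioi 0) := by
  simpa using integrableOn_abs_pow_mul_expH hs hc 0

/-! ### The two integral bounds -/

/-- **Upper bound for the moments of the weight**: for `(2/5) λ_s ≥ 1` and `κ = √((2/5)λ_s)`,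
`∫₀^∞ |u - a_s|^l e^{H_s(u) - H_s(a_s)} du ≤ 2e · l!/κ^{l+1}`. [folklore] -/
theorem integral_abs_pow_mul_expH_le {s : ℝ} (hs : 0 < s) (hc : 1 ≤ 2 / 5 * lam s) (l : ℕ) :
    ∫ u in Ioi 0, |u - saddle s| ^ l * exp (H s u - H s (saddle s)) ≤
      2 * exp 1 * (l ! : ℝ) / sqrt (2 / 5 * lam s) ^ (l + 1) := by
  set κ := sqrt (2 / 5 * lam s) with hκdef
  have hκ : 0 < κ := sqrt_pos.2 (by linarith)
  set G : ℝ → ℝ := fun u ↦ exp 1 * kfun κ l |u - saddle s| with hGdef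
  have hGi : Integrable G :=
    (((integrable_comp_abs_of_integrableOn (integrableOn_kfun hκ l)).comp_sub_right
      (saddle s)).const_mul (exp 1))
  have hG0 : ∀ u, 0 ≤ G u := fun u ↦ mul_nonneg (exp_pos 1).le (kfun_nonneg (abs_nonneg _) l)
  calc ∫ u in Ioi 0, |u - saddle s| ^ l * exp (H s u - H s (saddle s))
      ≤ ∫ u in Ioi 0, G u := setIntegral_mono_on (integrableOn_abs_pow_mul_expH hs hc l)
          hGi.integrableOn measurableSet_Ioi fun u hu ↦ abs_pow_mul_expH_le hs hc hu l
    _ ≤ ∫ u, G u := setIntegral_le_integral hGi (Eventually.of_forall hG0)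
    _ = exp 1 * ∫ u, kfun κ l |u - saddle s| := integral_const_mul _ _
    _ = exp 1 * ∫ t, kfun κ l |t| := by
        rw [integral_sub_right_eq_self (fun t ↦ kfun κ l |t|) (saddle s)]
    _ = exp 1 * (2 * ∫ t in Ioi 0, kfun κ l t) := by rw [integral_comp_abs]
    _ = 2 * exp 1 * (l ! : ℝ) / κ ^ (l + 1) := by rw [integral_kfun hκ]; ring

/-- **Lower bound for the total mass**: for `a_s ≥ 1` and `(2/5) λ_s ≥ 1`,
`∫₀^∞ e^{H_s(u) - H_s(a_s)} du ≥ e^{-5/16}/(4√λ_s)`. [folklore] -/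
theorem integral_expH_ge {s : ℝ} (hs : 0 < s) (ha : 1 ≤ saddle s) (hc : 1 ≤ 2 / 5 * lam s) :
    exp (-5 / 16) / (4 * sqrt (lam s)) ≤ ∫ u in Ioi 0, exp (H s u - H s (saddle s)) := by
  have hl : 1 ≤ lam s := by linarith
  have hsl : 1 ≤ sqrt (lam s) := by rwa [le_sqrt (by norm_num) (by linarith), one_pow]
  set r : ℝ := 1 / (4 * sqrt (lam s)) with hr
  have hr0 : 0 < r := by positivity
  have hr4 : r ≤ 1 / 4 := by
    rw [hr]; gcongr; linarith
  have hsub : Icc (saddle s) (saddle s + r) ⊆ Ioi 0 := fun u hu ↦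
    lt_of_lt_of_le one_pos (ha.trans hu.1)
  have hf0 : ∀ u, 0 ≤ exp (H s u - H s (saddle s)) := fun u ↦ (exp_pos _).le
  -- on the small interval the weight is ≥ e^{-5/16}
  have hloc : ∀ u ∈ Icc (saddle s) (saddle s + r),
      exp (-5 / 16) ≤ exp (H s u - H s (saddle s)) := by
    intro u hu
    have ht0 : 0 ≤ u - saddle s := by linarith [hu.1]
    have ht1 : u - saddle s ≤ r := by linarith [hu.2]
    have key := H_sub_ge hs ha ht0 (ht1.trans hr4)
    rw [add_sub_cancel] at key
    apply exp_le_exp.2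
    have h1 : lam s * (u - saddle s) ^ 2 ≤ lam s * r ^ 2 := by
      apply mul_le_mul_of_nonneg_left _ (by linarith); exact pow_le_pow_left₀ ht0 ht1 2
    have h2 : lam s * r ^ 2 = 1 / 16 := by
      rw [hr, div_pow, mul_pow, sq_sqrt (by linarith)]; field_simp; ring
    linarith
  calc exp (-5 / 16) / (4 * sqrt (lam s))
      = ∫ _ in Icc (saddle s) (saddle s + r), exp (-5 / 16 : ℝ) := by
        rw [setIntegral_const, measureReal_def, Real.volume_Icc, add_sub_cancel_left,
          ENNReal.toReal_ofReal hr0.le, smul_eq_mul, hr]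
        ring
    _ ≤ ∫ u in Icc (saddle s) (saddle s + r), exp (H s u - H s (saddle s)) :=
        setIntegral_mono_on (integrableOn_const (by simp)) ((integrableOn_expH hs hc).mono_set hsub)
          measurableSet_Icc hloc
    _ ≤ ∫ u in Ioi 0, exp (H s u - H s (saddle s)) :=
        setIntegral_mono_set (integrableOn_expH hs hc)
          (ae_restrict_of_forall_mem measurableSet_Ioi fun u _ ↦ hf0 u)
          (Eventually.of_forall hsub)

/-- **Concentration of the weight `u^s e^{ψ(u)}` at scale `λ_s^{-1/2}`**: for every `l` there is
`C_l` with `∫₀^∞ |u - a_s|^l e^{H_s(u)} du ≤ C_l λ_s^{-l/2} ∫₀^∞ e^{H_s(u)} du` whenever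
`a_s ≥ 1` and `λ_s ≥ 5/2` (both hold for all large `s`). [folklore] -/
theorem exists_moment_bound (l : ℕ) : ∃ C : ℝ, 0 < C ∧ ∀ s : ℝ, 0 < s → 1 ≤ saddle s →
    1 ≤ 2 / 5 * lam s →
    ∫ u in Ioi 0, |u - saddle s| ^ l * exp (H s u - H s (saddle s)) ≤
      C / sqrt (lam s) ^ l * ∫ u in Ioi 0, exp (H s u - H s (saddle s)) := by
  refine ⟨8 * exp 1 * (l ! : ℝ) * sqrt (5 / 2) ^ (l + 1) / exp (-5 / 16), by positivity, ?_⟩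
  intro s hs ha hc
  have hl : 0 < lam s := by linarith
  have hsl : 0 < sqrt (lam s) := sqrt_pos.2 hl
  have hup := integral_abs_pow_mul_expH_le hs hc l
  have hlow := integral_expH_ge hs ha hc
  have hκ : sqrt (2 / 5 * lam s) = sqrt (lam s) / sqrt (5 / 2) := by
    rw [show (2 : ℝ) / 5 * lam s = lam s / (5 / 2) by ring, sqrt_div hl.le]
  rw [hκ, div_pow, div_div_eq_mul_div] at hup
  have h52 : 0 < sqrt (5 / 2 : ℝ) := sqrt_pos.2 (by norm_num)
  have hC : 0 ≤ 8 * exp 1 * (l ! : ℝ) * sqrt (5 / 2) ^ (l + 1) / exp (-5 / 16) /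
      sqrt (lam s) ^ l := by
    positivity
  calc ∫ u in Ioi 0, |u - saddle s| ^ l * exp (H s u - H s (saddle s))
      ≤ 2 * exp 1 * (l ! : ℝ) * sqrt (5 / 2) ^ (l + 1) / sqrt (lam s) ^ (l + 1) := hup
    _ = 8 * exp 1 * (l ! : ℝ) * sqrt (5 / 2) ^ (l + 1) / exp (-5 / 16) / sqrt (lam s) ^ l *
          (exp (-5 / 16) / (4 * sqrt (lam s))) := by
        have he : exp (-5 / 16 : ℝ) ≠ 0 := (exp_pos _).ne'
        field_simp
        ring
    _ ≤ 8 * exp 1 * (l ! : ℝ) * sqrt (5 / 2) ^ (l + 1) / exp (-5 / 16) / sqrt (lam s) ^ l *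
          ∫ u in Ioi 0, exp (H s u - H s (saddle s)) :=
        mul_le_mul_of_nonneg_left hlow hC

end XiKernel

end Literature.NumberTheory.LFunctions

end
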